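import Summits.NavierStokesRegularity.NavierStokesRegularity.Theorems.SoloSalvageLietz2026ShellDecay
import HarnessLib

/-!
# NS-claims map, C167 (Lietz 2026): Thm 12.4's display (108), WITH its free `L¹` term, is TRUE along
# every classical solution — an honest constant majorant (kernel, records-grade vacuous-type column)

Companion of `SoloSalvageLietz2026ShellDecay.lean` (same claim C167, skeleton
`Literature.Claims.NS.Lietz2026`, typist ns-claims-typist-7 g8).  Thm 12.4 (108) p.18 l.4–16 prints
«P⁺_{β_ξ,K_ξ}(t) ≤ η Z_{β_ξ,K_ξ}(t) + B_β(t), B_β ∈ L¹(0, T)» with NO bound on `‖B_β‖_{L¹}` (REF RETYPE §1f: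
vacuous-type at print grain).  As typed (`Step_T124`, skeleton l.329) it holds along every classical
solution on `[0, T] × 𝕋³`, `T > 0`: take `K_ξ = 0`, `η = ½` and the CONSTANT `B_β ≡ 2^{15} K₁ K₂ · 4/3`,
where `K₁`, `K₂` bound `(1 − (4π²)⁻¹Δ)³ ω` and `(1 − (4π²)⁻¹Δ)² [(ω·∇)u − (u·∇)ω]` on the compact slab
(joint smoothness); then `‖ω̂(n)‖ ‖Ĝ(n)‖ ≤ K₁K₂ (1 + |n|²)⁻⁵`, `|T_k| ≤ 2^{15} K₁K₂ 2^{−7k}` on the sharp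
block (`#dyShell k ≤ 2^{3k+9}`, `2^{10k} ≤ 32(1+|n|²)⁵`), `2^{β_ξ k} ≤ 2^{5k}` (`β_ξ ≤ 5`), so every partial
sum of `P⁺_{β_ξ,0}(u t)` is `≤ 2^{15}K₁K₂ Σ (1/4)^k ≤ B_β` (`Real.tsum_le_of_sum_range_le`), while `Z ≥ 0`.

* `step_T124_holds : Literature.Claims.NS.Lietz2026.Step_T124`.

Records-grade object of ADJUDICATED #154 (announce-first INBOX 16:36:42Z; kit handed to a salvage seat;
split from the companion only for the 400-line rule).  Axioms: `propext`, `Classical.choice`,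
`Quot.sound` only.  WHAT THIS IS NOT: not a claim about NS regularity or blow-up; not a claim about
any author beyond the typed locator.
-/

noncomputable section

open Set MeasureTheory

-- The summit's canonical theorem namespace repeats the summit name (single-conjunct summit).
set_option linter.dupNamespace false

namespace Summit.NavierStokesRegularity.NavierStokesRegularity.Theorems.Lietz2026

open Literature.Analysis Literature.Analysis.FluidPDE Literature.Analysis.FunctionSpaces
open Literature.Claims.NS.Lietz2026
open Literature.Claims.NS.Higgins2026 (T3 E3 C3 Z3 coeff)

/-! ## Step 10 (Thm 12.4 (108) with its free `L¹` term) HOLDS — an honest constant majorant -/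

/-- Iterates of `b ↦ b − (4π²)⁻¹Δb` preserve joint smoothness. [folklore] -/
private theorem isSmoothSpaceTimeOn_iterate {S : Set ℝ} {w : ℝ → T3 → E3}
    (hw : Torus.IsSmoothSpaceTimeOn S w) (hS : UniqueDiffOn ℝ S) :
    ∀ m : ℕ, Torus.IsSmoothSpaceTimeOn S (fun t =>
      (fun b : T3 → E3 => fun x => b x - (4 * Real.pi ^ 2)⁻¹ • Torus.laplacian b x)^[m] (w t))
  | 0 => by simpa using hw
  | m + 1 => by
    have ih := isSmoothSpaceTimeOn_iterate hw hS m
    have h := ih.sub ((ih.laplacian hS).const_smul (4 * Real.pi ^ 2)⁻¹)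
    simp only [Function.iterate_succ_apply']
    exact h

/-- `D_k ≥ 0` for `ν ≥ 0`. [folklore] -/
private theorem Dk_nonneg {ν : ℝ} (hν : 0 ≤ ν) (k : ℕ) (v : T3 → E3) : 0 ≤ Dk ν k v := by
  unfold Dk
  have : 0 ≤ ∑ n ∈ dyShell k, Torus.freqNormSq n * ‖coeff (vort v) n‖ ^ 2 :=
    Finset.sum_nonneg fun n _ => mul_nonneg (Torus.freqNormSq_nonneg n) (sq_nonneg _)
  positivity

/-- `Z_{β,K} ≥ 0` (a `tsum` of nonnegative terms, junk `0` included). [folklore] -/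
private theorem Ztail_nonneg {ν : ℝ} (hν : 0 ≤ ν) (β : ℝ) (K : ℕ) (v : T3 → E3) :
    0 ≤ Ztail ν β K v := by
  unfold Ztail
  refine tsum_nonneg fun k => ?_
  split_ifs
  · exact mul_nonneg (by positivity) (Dk_nonneg hν k v)
  · exact le_rfl

/-- On the sharp block, `2^{10k} ≤ 32 (1 + |n|²)⁵`. [folklore] -/
private theorem two_pow_ten_le_of_mem_dyShell {k : ℕ} {n : Z3} (hn : n ∈ dyShell k) :
    (2 : ℝ) ^ (10 * k) ≤ 32 * (1 + Torus.freqNormSq n) ^ 5 := by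
  have h := two_pow_lt_of_mem_dyShell hn
  have h0 : 0 ≤ Torus.freqNormSq n := Torus.freqNormSq_nonneg n
  have h1 : (2 : ℝ) ^ (2 * k) ≤ 2 * (1 + Torus.freqNormSq n) := by linarith
  calc (2 : ℝ) ^ (10 * k) = ((2 : ℝ) ^ (2 * k)) ^ 5 := by rw [← pow_mul]; ring_nf
    _ ≤ (2 * (1 + Torus.freqNormSq n)) ^ 5 := by gcongr
    _ = 32 * (1 + Torus.freqNormSq n) ^ 5 := by ring

/-- **The transfer term is summable against `2^{β_ξ k}` on a smooth slab.** If on `𝕋³`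
`‖((1 − (4π²)⁻¹Δ)³ ω)(x)‖ ≤ K₁` and `‖((1 − (4π²)⁻¹Δ)² G)(x)‖ ≤ K₂` (`ω = vort v`, `G = (ω·∇)v − (v·∇)ω`,
both smooth), then `2^{β_ξ k} T⁺_k(v) ≤ 2^{15} K₁ K₂ (1/4)^k`. [cite: Lietz2026, Lemma 12.1 proof (102) p.16 l.37–48] -/
private theorem weighted_Tplus_le {v : T3 → E3} (hω : Torus.IsSmooth (vort v))
    (hG : Torus.IsSmooth (stretchAdv v)) {K₁ K₂ : ℝ}
    (hK₁ : ∀ x, ‖((fun b : T3 → E3 => fun x => b x - (4 * Real.pi ^ 2)⁻¹ • Torus.laplacian b x)^[3]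
      (vort v)) x‖ ≤ K₁)
    (hK₂ : ∀ x, ‖((fun b : T3 → E3 => fun x => b x - (4 * Real.pi ^ 2)⁻¹ • Torus.laplacian b x)^[2]
      (stretchAdv v)) x‖ ≤ K₂) (k : ℕ) :
    (2 : ℝ) ^ (betaXi * k) * Tplus k v ≤ 2 ^ 15 * K₁ * K₂ * (1 / 4 : ℝ) ^ k := by
  have hK₁0 : 0 ≤ K₁ := (norm_nonneg _).trans (hK₁ 0)
  have hK₂0 : 0 ≤ K₂ := (norm_nonneg _).trans (hK₂ 0)
  have hc1 : ∀ n : Z3, ‖coeff (vort v) n‖ ≤ K₁ * ((1 + Torus.freqNormSq n) ^ 3)⁻¹ := fun n =>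
    Torus.norm_mFourierCoeff_le_of_iterate_bound hω hK₁ n
  have hc2 : ∀ n : Z3, ‖coeff (stretchAdv v) n‖ ≤ K₂ * ((1 + Torus.freqNormSq n) ^ 2)⁻¹ := fun n =>
    Torus.norm_mFourierCoeff_le_of_iterate_bound hG hK₂ n
  have hpos : (0 : ℝ) < 2 ^ (10 * k) := by positivity
  -- termwise bound on the block
  have hterm : ∀ n ∈ dyShell k,
      (inner ℂ (coeff (vort v) n) (coeff (stretchAdv v) n)).re ≤ 32 * K₁ * K₂ * ((2 : ℝ) ^ (10 * k))⁻¹ := by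
    intro n hn
    have h1 : 0 < 1 + Torus.freqNormSq n := by linarith [Torus.freqNormSq_nonneg n]
    have hre : (inner ℂ (coeff (vort v) n) (coeff (stretchAdv v) n)).re ≤
        ‖coeff (vort v) n‖ * ‖coeff (stretchAdv v) n‖ :=
      (le_abs_self _).trans ((Complex.abs_re_le_norm _).trans (norm_inner_le_norm _ _))
    have hprod : ‖coeff (vort v) n‖ * ‖coeff (stretchAdv v) n‖ ≤
        (K₁ * ((1 + Torus.freqNormSq n) ^ 3)⁻¹) * (K₂ * ((1 + Torus.freqNormSq n) ^ 2)⁻¹) :=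
      mul_le_mul (hc1 n) (hc2 n) (norm_nonneg _) (by positivity)
    have h10 := two_pow_ten_le_of_mem_dyShell hn
    have hinv : ((1 + Torus.freqNormSq n) ^ 5)⁻¹ ≤ 32 * ((2 : ℝ) ^ (10 * k))⁻¹ := by
      have e : ((1 + Torus.freqNormSq n) ^ 5)⁻¹ = 32 * (32 * (1 + Torus.freqNormSq n) ^ 5)⁻¹ := by
        field_simp
      rw [e]
      exact mul_le_mul_of_nonneg_left (inv_anti₀ hpos h10) (by norm_num)
    calc (inner ℂ (coeff (vort v) n) (coeff (stretchAdv v) n)).re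
        ≤ (K₁ * ((1 + Torus.freqNormSq n) ^ 3)⁻¹) * (K₂ * ((1 + Torus.freqNormSq n) ^ 2)⁻¹) :=
          hre.trans hprod
      _ = K₁ * K₂ * ((1 + Torus.freqNormSq n) ^ 5)⁻¹ := by field_simp
      _ ≤ K₁ * K₂ * (32 * ((2 : ℝ) ^ (10 * k))⁻¹) := by gcongr
      _ = 32 * K₁ * K₂ * ((2 : ℝ) ^ (10 * k))⁻¹ := by ring
  -- the transfer term
  have hTk : Tk k v ≤ (dyShell k).card * (64 * K₁ * K₂ * ((2 : ℝ) ^ (10 * k))⁻¹) := by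
    unfold Tk
    have hs := Finset.sum_le_card_nsmul (dyShell k)
      (fun n => (inner ℂ (coeff (vort v) n) (coeff (stretchAdv v) n)).re)
      (32 * K₁ * K₂ * ((2 : ℝ) ^ (10 * k))⁻¹) hterm
    rw [nsmul_eq_mul] at hs
    nlinarith [hs, Nat.cast_nonneg (α := ℝ) (dyShell k).card]
  have hcard := card_dyShell_le k
  have hTk' : Tk k v ≤ 2 ^ 15 * K₁ * K₂ * ((2 : ℝ) ^ (3 * k) * ((2 : ℝ) ^ (10 * k))⁻¹) := by
    have h39 : (2 : ℝ) ^ (3 * k + 9) = 2 ^ 9 * (2 : ℝ) ^ (3 * k) := by rw [pow_add]; ring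
    calc Tk k v ≤ (dyShell k).card * (64 * K₁ * K₂ * ((2 : ℝ) ^ (10 * k))⁻¹) := hTk
      _ ≤ (2 : ℝ) ^ (3 * k + 9) * (64 * K₁ * K₂ * ((2 : ℝ) ^ (10 * k))⁻¹) := by gcongr
      _ = 2 ^ 15 * K₁ * K₂ * ((2 : ℝ) ^ (3 * k) * ((2 : ℝ) ^ (10 * k))⁻¹) := by rw [h39]; ring
  have hTplus : Tplus k v ≤ 2 ^ 15 * K₁ * K₂ * ((2 : ℝ) ^ (3 * k) * ((2 : ℝ) ^ (10 * k))⁻¹) :=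
    max_le hTk' (by positivity)
  -- the weight `2^{β_ξ k} ≤ 2^{5k}`
  have hw : (2 : ℝ) ^ (betaXi * k) ≤ (2 : ℝ) ^ (5 * k) := by
    rw [← Real.rpow_natCast 2 (5 * k)]
    apply Real.rpow_le_rpow_of_exponent_le one_le_two
    push_cast
    nlinarith [betaXi_le_five, Nat.cast_nonneg (α := ℝ) k]
  have halg : (2 : ℝ) ^ (5 * k) * ((2 : ℝ) ^ (3 * k) * ((2 : ℝ) ^ (10 * k))⁻¹) = (1 / 4 : ℝ) ^ k := by
    have h2k : (2 : ℝ) ^ (10 * k) = 2 ^ (5 * k) * 2 ^ (3 * k) * 4 ^ k := by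
      rw [show (4 : ℝ) = 2 ^ 2 by norm_num, ← pow_mul, ← pow_add, ← pow_add]; ring_nf
    rw [h2k, one_div, inv_pow]
    field_simp
  calc (2 : ℝ) ^ (betaXi * k) * Tplus k v
      ≤ (2 : ℝ) ^ (5 * k) * (2 ^ 15 * K₁ * K₂ * ((2 : ℝ) ^ (3 * k) * ((2 : ℝ) ^ (10 * k))⁻¹)) :=
        mul_le_mul hw hTplus (le_max_right _ _) (by positivity)
    _ = 2 ^ 15 * K₁ * K₂ * ((2 : ℝ) ^ (5 * k) * ((2 : ℝ) ^ (3 * k) * ((2 : ℝ) ^ (10 * k))⁻¹)) := by ring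
    _ = 2 ^ 15 * K₁ * K₂ * (1 / 4 : ℝ) ^ k := by rw [halg]

/-- **Step 10 `Step_T124` HOLDS (kernel)** — Thm 12.4 (108) AS PRINTED, i.e. with its free `L¹` term:
along a classical solution on `[0, T] × 𝕋³` take `K_ξ = 0`, `η = ½` and the CONSTANT
`B_β ≡ 2^{15} K₁ K₂ · 4/3` (integrable on `(0, T)`), an honest majorant of `P⁺_{β_ξ,0}(u t)` for every
`t ∈ [0, T]` by `weighted_Tplus_le` and the geometric series (`Real.tsum_le_of_sum_range_le`); `Z ≥ 0`.
This is the vacuous-type content the REF recorded (RETYPE §1f): the print puts no bound on `‖B_β‖_{L¹}`.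
[cite: Lietz2026, Thm 12.4 (108) p.18 l.4–16] -/
theorem step_T124_holds : Literature.Claims.NS.Lietz2026.Step_T124 := by
  intro ν hν T hT u p hsol
  have hS : UniqueDiffOn ℝ (Icc (0 : ℝ) T) := uniqueDiffOn_Icc hT
  have hu := hsol.smooth_velocity
  have hω : Torus.IsSmoothSpaceTimeOn (Icc 0 T) (fun t => vort (u t)) := isSmoothSpaceTimeOn_vort hu hS
  have hG : Torus.IsSmoothSpaceTimeOn (Icc 0 T) (fun t => stretchAdv (u t)) :=
    (hω.convect hu hS).sub (hu.convect hω hS)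
  obtain ⟨K₁, hK₁⟩ := (isSmoothSpaceTimeOn_iterate hω hS 3).exists_norm_le_of_isCompact
    isCompact_Icc Subset.rfl
  obtain ⟨K₂, hK₂⟩ := (isSmoothSpaceTimeOn_iterate hG hS 2).exists_norm_le_of_isCompact
    isCompact_Icc Subset.rfl
  set B : ℝ := 2 ^ 15 * K₁ * K₂ * (4 / 3) with hB
  refine ⟨0, 1 / 2, by norm_num, by norm_num, fun _ => B, ?_, fun t ht => ?_⟩
  · exact (continuousOn_const.integrableOn_compact isCompact_Icc).mono_set Ioo_subset_Icc_self
  · have hωt : Torus.IsSmooth (vort (u t)) := hω.isSmooth_slice ht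
    have hGt : Torus.IsSmooth (stretchAdv (u t)) := hG.isSmooth_slice ht
    have hk : ∀ k : ℕ, (2 : ℝ) ^ (betaXi * k) * Tplus k (u t) ≤ 2 ^ 15 * K₁ * K₂ * (1 / 4 : ℝ) ^ k :=
      fun k => weighted_Tplus_le hωt hGt (fun x => hK₁ t ht x) (fun x => hK₂ t ht x) k
    have hK₁0 : 0 ≤ K₁ := (norm_nonneg _).trans (hK₁ t ht 0)
    have hK₂0 : 0 ≤ K₂ := (norm_nonneg _).trans (hK₂ t ht 0)
    have hgeom : ∀ n : ℕ, ∑ i ∈ Finset.range n, (1 / 4 : ℝ) ^ i ≤ 4 / 3 := by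
      intro n
      have hs : Summable fun i : ℕ => (1 / 4 : ℝ) ^ i :=
        summable_geometric_of_lt_one (by norm_num) (by norm_num)
      have ht' : ∑' i : ℕ, (1 / 4 : ℝ) ^ i = 4 / 3 := by
        rw [tsum_geometric_of_lt_one (by norm_num) (by norm_num)]; norm_num
      rw [← ht']
      exact hs.sum_le_tsum (Finset.range n) (fun i _ => by positivity)
    have hP : Ptail betaXi 0 (u t) ≤ B := by
      unfold Ptail
      refine Real.tsum_le_of_sum_range_le (fun k => ?_) (fun n => ?_)
      · rw [if_pos (Nat.zero_le k)]
        exact mul_nonneg (by positivity) (le_max_right _ _)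
      · calc ∑ i ∈ Finset.range n, (if 0 ≤ i then (2 : ℝ) ^ (betaXi * i) * Tplus i (u t) else 0)
            = ∑ i ∈ Finset.range n, (2 : ℝ) ^ (betaXi * i) * Tplus i (u t) :=
              Finset.sum_congr rfl fun i _ => if_pos (Nat.zero_le i)
          _ ≤ ∑ i ∈ Finset.range n, 2 ^ 15 * K₁ * K₂ * (1 / 4 : ℝ) ^ i := Finset.sum_le_sum fun i _ => hk i
          _ = 2 ^ 15 * K₁ * K₂ * ∑ i ∈ Finset.range n, (1 / 4 : ℝ) ^ i := by rw [Finset.mul_sum]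
          _ ≤ 2 ^ 15 * K₁ * K₂ * (4 / 3) := by gcongr; exact hgeom n
    have hZ := Ztail_nonneg hν.le betaXi 0 (u t)
    linarith

end Summit.NavierStokesRegularity.NavierStokesRegularity.Theorems.Lietz2026

end
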